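import Literature.RepresentationTheory.MoeglinVignerasWaldspurger1987.SBDeltaFunctionalNotFourierInvariant
import HarnessLib

/-!
# An invariant functional read in a CONJUGATE Schrödinger model vanishes: the soft-road kernel (S1+S2) through an implementer `Γ`

[MoeglinVignerasWaldspurger1987] C. Mœglin, M.-F. Vignéras, J.-L. Waldspurger, *Correspondances de Howe sur un corps `p`-adique*, LNM 1291 (1987),
Chap. 2 II.1–II.2 (two polarisations of the same symplectic space have Schrödinger models intertwined by an implementer; the Weyl element acts by
the Fourier transform, the unipotent radical of the Siegel parabolic by second-degree characters), Chap. 3 §IV.4 (rank-one theta dichotomy);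
[WeilBNT1967, Chap. VII §2, Cor. 1].  Topic `RepresentationTheory/MoeglinVignerasWaldspurger1987`; namespace
`Literature.RepresentationTheory.MoeglinVignerasWaldspurger1987` (sequel of ★ `SBDeltaFunctionalNotFourierInvariant` (S2) ∕ ★
`SBFunctionalInvariantUnderAnisotropicCharacterIsDelta` (S1)).  KERNEL ONLY: theorems, no definition, no named fact, no instance, no notation, no
`sorry`.  Cell hodgecm-mathlib (D-0151), half A line LD2, SOFT road (π3), brick (Z-van) of LD2-plan (g3) DEALS #16 (2) — its ABSTRACT CORE (seat
A-p19 (g31)); `--supports stmt-HodgeConjecture-24832`.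

THE STATEMENT (`functional_eq_zero_of_invariant_of_conjugate_model`).  `F` non-archimedean local (Haar `μ`, `ψ` continuous non-trivial of conductor
exponent `m`, locally constant), `ι` a NON-EMPTY finite type, `c` a linear map with `halfForm c` ANISOTROPIC; `V` any complex vector space with a
linear isomorphism `Γ : V ≃ₗ 𝒮(F^ι)` (an IMPLEMENTER between two models); `σ : G → End V` ANY family of operators indexed by any type `G` containing
«unipotent» elements `n b` (`b ∈ F`) acting in the `Γ`-model by the second-degree characters, `σ (n b) = Γ⁻¹ ∘ unipOpPi (b • c) ∘ Γ`, and a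
«Weyl» element `w` acting by a multiple of the Fourier operator, `σ w = γ • Γ⁻¹ ∘ 𝓕 ∘ Γ` (`𝓕 = fourierOpPi μ hψ hm`, ANY `γ : ℂ`).  THEN every
linear functional `Λ : V →ₗ ℂ` with `Λ (σ g Ψ) = Λ Ψ` for all `g, Ψ` is ZERO.  PROOF: `Λ′ := Λ ∘ Γ⁻¹` is invariant under every `unipOpPi (b • c)`
(`functional_comp_symm_unipOpPi_eq`) and satisfies `Λ′ ∘ 𝓕 = γ⁻¹ Λ′` when `γ ≠ 0` (`functional_comp_symm_fourierOpPi_eq`), so ★ (S1+S2)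
`functional_eq_zero_of_forall_unipOpPi_eq_of_fourierOpPi` gives `Λ′ = 0`; if `γ = 0` then `σ w = 0` and `Λ Ψ = Λ (σ w Ψ) = 0` directly.
USE (the (Z-van) socket of the LD2 soft-road junction): `V = 𝒮(L⁺_v^{2+2})` in the Schrödinger model of Kudla's doubled CM datum, `σ = s′` the
twisted doubled Weil section through the Kronecker embedding `ι : U(W ⊕ −W) → U(V ⊕ −V)`, `n b = ι(n_Δ(b))`, `w = ι(w_Δ)`, `Γ` the implementer of the
datum's `Δ`-adapted symplectic basis, `c = t₀₀ • Q_T` the anisotropic norm form of the hermitian plane: hypotheses (GRP-N), (GRP-W), (AN) of DEALS #16.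
HONEST LABEL: pure non-archimedean analysis plus linear algebra; nothing of [Liu2021] asserted.  HC_CM is proved only modulo the 7 printed citations
(2 remaining: hLiu418 = stmt-HodgeConjecture-24832, h413 = stmt-HodgeConjecture-24833) until rung 0 closes; count-neutral.

## References
* [MoeglinVignerasWaldspurger1987] LNM 1291 (1987), Chap. 2 II.1–II.2; Chap. 3 §IV.4.
* [WeilBNT1967] A. Weil, *Basic Number Theory* (1967), Chap. VII §2, Cor. 1.
* [Rangarao1993] R. Ranga Rao, Pacific J. Math. 157 (1993), §3.1 (3.8)–(3.9) (the operators `r(n(c))`, `r(w)`).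
-/

set_option autoImplicit false

noncomputable section

namespace Literature.RepresentationTheory.MoeglinVignerasWaldspurger1987

open MeasureTheory
open Literature.RepresentationTheory.HeisenbergGroup
open Literature.NumberTheory.Automorphic
open Literature.NumberTheory.GaloisRepresentations.IsNonarchimedeanLocalField
open scoped Pointwise

variable {F : Type*} [Field F] [ValuativeRel F] [TopologicalSpace F] [IsNonarchimedeanLocalField F]
  {ι : Type*} [Fintype ι] {ψ : AddChar F Circle}

/-! ## §1 (S2′) a functional supported at `0` is not an eigenfunctional of `A ∘ 𝓕` for any `A` reading the value at `0` -/

/-- **(S2′) A FUNCTIONAL SUPPORTED AT `0` IS NOT AN `A ∘ 𝓕`-EIGENFUNCTIONAL** for any linear `A` on `𝒮(F^ι)` that READS THE VALUE AT `0` up to a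
non-zero constant (`(A g)(0) = κ · g(0)`, `κ ≠ 0`; e.g. `A = γ • 1`, or a Levi operator `r(m(B))`, ★ `coe_leviOpPi_apply`): `Λ f = 0` whenever
`f 0 = 0`, and `Λ (A (r(w) f)) = γ Λ f` for all `f`, force `Λ = 0` (`ι` non-empty).  Same test function as ★
`functional_eq_zero_of_forall_apply_zero_of_fourierOpPi` (`𝟙_{a + (𝔭^N)^ι}`, `a ∉ (𝔭^N)^ι`).
[cite: MoeglinVignerasWaldspurger1987, Chap. 2 II.1–II.2; Chap. 3 §IV.4] [cite: WeilBNT1967, Chap. VII §2, Cor. 1] -/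
theorem functional_eq_zero_of_forall_apply_zero_of_op_fourierOpPi [Nonempty ι] [MeasurableSpace F] [BorelSpace F]
    (μ : Measure F) [μ.IsAddHaarMeasure] {m : ℤ} (hψ : ψ.IsContinuousNontrivial) (hm : ψ.HasConductorExp m)
    (Λ : SchwartzBruhat (ι → F) →ₗ[ℂ] ℂ) (hΛ0 : ∀ f : SchwartzBruhat (ι → F), (f : (ι → F) → ℂ) 0 = 0 → Λ f = 0)
    (A : SchwartzBruhat (ι → F) →ₗ[ℂ] SchwartzBruhat (ι → F)) (κ : ℂ) (hκ : κ ≠ 0)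
    (hA : ∀ g : SchwartzBruhat (ι → F), ((A g : SchwartzBruhat (ι → F)) : (ι → F) → ℂ) 0 = κ * (g : (ι → F) → ℂ) 0)
    (γ : ℂ) (hΛF : ∀ f : SchwartzBruhat (ι → F), Λ (A (fourierOpPi μ hψ hm f)) = γ * Λ f) : Λ = 0 := by
  classical
  haveI : SecondCountableTopology F := secondCountableTopology_localField F
  haveI : T2Space F := (isLocalField F).toT2Space
  -- the normalising function `φ = 𝟙_{𝒪^ι}`, `φ 0 = 1`
  let φ : SchwartzBruhat (ι → F) :=
    ⟨(piPrimePowBall F ι 0).indicator fun _ => (1 : ℂ), indicator_piPrimePowBall_mem_schwartzBruhat 0 1⟩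
  have hφ : (φ : (ι → F) → ℂ) 0 = 1 := by
    change (piPrimePowBall F ι 0).indicator (fun _ => (1 : ℂ)) 0 = 1
    exact Set.indicator_of_mem (zero_mem_piPrimePowBall 0) _
  -- a box `(𝔭^N)^ι` missing the non-zero vector `a = (1, …, 1)`
  let a : ι → F := fun _ => 1
  have ha : a ≠ 0 := fun h => one_ne_zero (congr_fun h (Classical.arbitrary ι))
  obtain ⟨N, hN⟩ := exists_piPrimePowBall_subset_of_mem_nhds_zero (F := F) (ι := ι) (isOpen_ne.mem_nhds ha.symm)
  have haN : a ∉ piPrimePowBall F ι (N : ℤ) := fun h => hN h rfl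
  -- the test function `f = 𝟙_{a + (𝔭^N)^ι}`
  let f : SchwartzBruhat (ι → F) :=
    ⟨(a +ᵥ piPrimePowBall F ι (N : ℤ)).indicator fun _ => (1 : ℂ), indicator_vadd_piPrimePowBall_mem_schwartzBruhat (N : ℤ) a 1⟩
  have hf0 : (f : (ι → F) → ℂ) 0 = 0 := by
    change (a +ᵥ piPrimePowBall F ι (N : ℤ)).indicator (fun _ => (1 : ℂ)) 0 = 0
    refine Set.indicator_of_notMem (fun h0 => haN ?_) _
    have h' : (0 : ι → F) - a ∈ piPrimePowBall F ι (N : ℤ) := mem_vadd_piPrimePowBall_iff.1 h0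
    rw [zero_sub] at h'
    simpa using neg_mem_piPrimePowBall h'
  -- its Fourier transform at `0` is the (positive) measure of the box
  have hFf0 : ((fourierOpPi μ hψ hm f : SchwartzBruhat (ι → F)) : (ι → F) → ℂ) 0 =
      ((Measure.pi fun _ : ι => μ).real (piPrimePowBall F ι (N : ℤ)) : ℂ) := by
    rw [coe_fourierOpPi]
    change piFourierSB ψ (Measure.pi fun _ : ι => μ) ((a +ᵥ piPrimePowBall F ι (N : ℤ)).indicator fun _ => (1 : ℂ)) 0 = _
    rw [piFourierSB_indicator_vadd_piPrimePowBall _ hm, dotProduct_zero, AddChar.map_zero_eq_one, Circle.coe_one, one_mul,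
      if_pos (zero_mem_piPrimePowBall _)]
  have hpos : (0 : ℝ) < (Measure.pi fun _ : ι => μ).real (piPrimePowBall F ι (N : ℤ)) := measureReal_piPrimePowBall_pos _ _
  -- compare `Λ (A (r(w) f)) = γ Λ f = 0` with `Λ (A (r(w) f)) = κ · μ(box) · Λ 𝟙`
  have h1 : Λ (A (fourierOpPi μ hψ hm f)) = 0 := by
    rw [hΛF, functional_apply_eq_apply_zero_mul Λ hΛ0 φ hφ f, hf0, zero_mul, mul_zero]
  have h2 := functional_apply_eq_apply_zero_mul Λ hΛ0 φ hφ (A (fourierOpPi μ hψ hm f))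
  rw [h1, hA, hFf0] at h2
  have hunit : Λ φ = 0 := by
    rcases mul_eq_zero.1 h2.symm with h | h
    · rcases mul_eq_zero.1 h with h' | h'
      · exact absurd h' hκ
      · exact absurd (by exact_mod_cast h') hpos.ne'
    · exact h
  ext g
  rw [functional_apply_eq_apply_zero_mul Λ hΛ0 φ hφ g, hunit, mul_zero, LinearMap.zero_apply]

/-- **(S1+S2′) THE SOFT-ROAD KERNEL WITH A LEVI FACTOR**: a functional on `𝒮(F^ι)` invariant under every `r(n(b c))` (`halfForm c` anisotropic)
and satisfying `Λ ∘ A ∘ 𝓕 = γ Λ` for some linear `A` reading the value at `0` (`(A g)(0) = κ g(0)`, `κ ≠ 0`) is ZERO (★ (S1)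
`functional_apply_eq_zero_of_forall_unipOpPi_eq` + (S2′)). [cite: MoeglinVignerasWaldspurger1987, Chap. 2 I.3–I.4, II.1–II.2; Chap. 3 §IV.4]
[cite: WeilBNT1967, Chap. VII §2, Cor. 1] -/
theorem functional_eq_zero_of_forall_unipOpPi_eq_of_op_fourierOpPi [Nonempty ι] [Invertible (2 : F)] [MeasurableSpace F] [BorelSpace F]
    (μ : Measure F) [μ.IsAddHaarMeasure] {m : ℤ} (hψ : ψ.IsContinuousNontrivial) (hm : ψ.HasConductorExp m)
    (hl : IsLocallyConstant (⇑ψ : F → Circle)) (c : (ι → F) →ₗ[F] (ι → F)) (hc : ∀ x : ι → F, halfForm c x = 0 → x = 0)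
    (Λ : SchwartzBruhat (ι → F) →ₗ[ℂ] ℂ) (hΛN : ∀ (b : F) (f : SchwartzBruhat (ι → F)), Λ (unipOpPi hl (b • c) f) = Λ f)
    (A : SchwartzBruhat (ι → F) →ₗ[ℂ] SchwartzBruhat (ι → F)) (κ : ℂ) (hκ : κ ≠ 0)
    (hA : ∀ g : SchwartzBruhat (ι → F), ((A g : SchwartzBruhat (ι → F)) : (ι → F) → ℂ) 0 = κ * (g : (ι → F) → ℂ) 0)
    (γ : ℂ) (hΛF : ∀ f : SchwartzBruhat (ι → F), Λ (A (fourierOpPi μ hψ hm f)) = γ * Λ f) : Λ = 0 :=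
  have hψ1 : ∃ a : F, ((ψ a : Circle) : ℂ) ≠ 1 := by
    obtain ⟨a, -, ha⟩ := hm.2
    exact ⟨a, fun h => ha (Circle.ext h)⟩
  functional_eq_zero_of_forall_apply_zero_of_op_fourierOpPi μ hψ hm Λ
    (fun f hf0 => functional_apply_eq_zero_of_forall_unipOpPi_eq hl hψ1 c hc Λ hΛN f hf0) A κ hκ hA γ hΛF

/-! ## §2 Transport through an implementer `Γ : V ≃ₗ 𝒮(F^ι)` -/

/-- **invariance transports to the `Γ`-model**: if `σ (n b) = Γ⁻¹ ∘ unipOpPi (b • c) ∘ Γ` and `Λ` is `σ`-invariant, then `Λ ∘ Γ⁻¹` is invariant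
under every `unipOpPi (b • c)` (the hypothesis `hΛN` of ★ `functional_eq_zero_of_forall_unipOpPi_eq_of_fourierOpPi`).
[cite: MoeglinVignerasWaldspurger1987, Chap. 2 II.1–II.2] [cite: Rangarao1993, §3.1 (3.8)] -/
theorem functional_comp_symm_unipOpPi_eq [Invertible (2 : F)] (hl : IsLocallyConstant (⇑ψ : F → Circle))
    (c : (ι → F) →ₗ[F] (ι → F))
    {V : Type*} [AddCommGroup V] [Module ℂ V] (Γ : V ≃ₗ[ℂ] SchwartzBruhat (ι → F))
    {G : Type*} (σ : G → V →ₗ[ℂ] V) (n : F → G)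
    (hn : ∀ (b : F) (Ψ : V), σ (n b) Ψ = Γ.symm (unipOpPi hl (b • c) (Γ Ψ)))
    (Λ : V →ₗ[ℂ] ℂ) (hΛ : ∀ (g : G) (Ψ : V), Λ (σ g Ψ) = Λ Ψ) (b : F) (f : SchwartzBruhat (ι → F)) :
    (Λ ∘ₗ Γ.symm.toLinearMap) (unipOpPi hl (b • c) f) = (Λ ∘ₗ Γ.symm.toLinearMap) f := by
  have h := hΛ (n b) (Γ.symm f)
  rw [hn, LinearEquiv.apply_symm_apply] at h
  simpa only [LinearMap.coe_comp, Function.comp_apply, LinearEquiv.coe_coe] using h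

/-- **the Fourier eigen-relation transports to the `Γ`-model**: if `σ w = γ • Γ⁻¹ ∘ 𝓕 ∘ Γ` with `γ ≠ 0` and `Λ` is `σ`-invariant, then
`(Λ ∘ Γ⁻¹) (𝓕 f) = γ⁻¹ · (Λ ∘ Γ⁻¹) f` (the hypothesis `hΛF` of ★ `functional_eq_zero_of_forall_unipOpPi_eq_of_fourierOpPi`).
[cite: MoeglinVignerasWaldspurger1987, Chap. 2 II.1–II.2] [cite: Rangarao1993, §3.1 (3.9)] -/
theorem functional_comp_symm_fourierOpPi_eq [MeasurableSpace F] [BorelSpace F]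
    (μ : Measure F) [μ.IsAddHaarMeasure] {m : ℤ} (hψ : ψ.IsContinuousNontrivial) (hm : ψ.HasConductorExp m)
    {V : Type*} [AddCommGroup V] [Module ℂ V] (Γ : V ≃ₗ[ℂ] SchwartzBruhat (ι → F))
    {G : Type*} (σ : G → V →ₗ[ℂ] V) (w : G) (γ : ℂ) (hγ : γ ≠ 0)
    (hw : ∀ Ψ : V, σ w Ψ = γ • Γ.symm (fourierOpPi μ hψ hm (Γ Ψ)))
    (Λ : V →ₗ[ℂ] ℂ) (hΛ : ∀ (g : G) (Ψ : V), Λ (σ g Ψ) = Λ Ψ) (f : SchwartzBruhat (ι → F)) :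
    (Λ ∘ₗ Γ.symm.toLinearMap) (fourierOpPi μ hψ hm f) = γ⁻¹ * (Λ ∘ₗ Γ.symm.toLinearMap) f := by
  have h := hΛ w (Γ.symm f)
  rw [hw, LinearEquiv.apply_symm_apply, map_smul, smul_eq_mul] at h
  simp only [LinearMap.coe_comp, Function.comp_apply, LinearEquiv.coe_coe]
  rw [← h, ← mul_assoc, inv_mul_cancel₀ hγ, one_mul]

/-! ## §3 The two heads -/

/-- **AN INVARIANT FUNCTIONAL READ IN A CONJUGATE MODEL VANISHES** — the soft-road kernel ★ (S1+S2) `functional_eq_zero_of_forall_unipOpPi_eq_of_fourierOpPi`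
through an implementer `Γ : V ≃ₗ 𝒮(F^ι)`: for ANY operator family `σ : G → End V` with `σ (n b) = Γ⁻¹ ∘ unipOpPi (b • c) ∘ Γ` (`halfForm c` anisotropic)
and `σ w = γ • Γ⁻¹ ∘ 𝓕 ∘ Γ` (any `γ`), every `σ`-invariant linear functional `Λ` on `V` is `0` (`γ = 0`: `Λ = Λ ∘ σ w = 0`; `γ ≠ 0`: (S1+S2) for `Λ ∘ Γ⁻¹`
with eigenvalue `γ⁻¹`). [cite: MoeglinVignerasWaldspurger1987, Chap. 2 II.1–II.2; Chap. 3 §IV.4] [cite: WeilBNT1967, Chap. VII §2, Cor. 1] -/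
theorem functional_eq_zero_of_invariant_of_conjugate_model [Nonempty ι] [Invertible (2 : F)] [MeasurableSpace F] [BorelSpace F]
    (μ : Measure F) [μ.IsAddHaarMeasure] {m : ℤ} (hψ : ψ.IsContinuousNontrivial) (hm : ψ.HasConductorExp m)
    (hl : IsLocallyConstant (⇑ψ : F → Circle)) (c : (ι → F) →ₗ[F] (ι → F)) (hc : ∀ x : ι → F, halfForm c x = 0 → x = 0)
    {V : Type*} [AddCommGroup V] [Module ℂ V] (Γ : V ≃ₗ[ℂ] SchwartzBruhat (ι → F))
    {G : Type*} (σ : G → V →ₗ[ℂ] V) (n : F → G)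
    (hn : ∀ (b : F) (Ψ : V), σ (n b) Ψ = Γ.symm (unipOpPi hl (b • c) (Γ Ψ)))
    (w : G) (γ : ℂ) (hw : ∀ Ψ : V, σ w Ψ = γ • Γ.symm (fourierOpPi μ hψ hm (Γ Ψ)))
    (Λ : V →ₗ[ℂ] ℂ) (hΛ : ∀ (g : G) (Ψ : V), Λ (σ g Ψ) = Λ Ψ) : Λ = 0 := by
  by_cases hγ : γ = 0
  · -- `σ w = 0`, so `Λ Ψ = Λ (σ w Ψ) = 0`
    ext Ψ
    rw [← hΛ w Ψ, hw, hγ, zero_smul, map_zero, LinearMap.zero_apply]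
  · have hΛ' : Λ ∘ₗ Γ.symm.toLinearMap = 0 :=
      functional_eq_zero_of_forall_unipOpPi_eq_of_fourierOpPi μ hψ hm hl c hc (Λ ∘ₗ Γ.symm.toLinearMap)
        (functional_comp_symm_unipOpPi_eq hl c Γ σ n hn Λ hΛ) γ⁻¹
        (functional_comp_symm_fourierOpPi_eq μ hψ hm Γ σ w γ hγ hw Λ hΛ)
    ext Ψ
    have h := LinearMap.congr_fun hΛ' (Γ Ψ)
    rw [LinearMap.coe_comp, Function.comp_apply, LinearEquiv.coe_coe, LinearEquiv.symm_apply_apply,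
      LinearMap.zero_apply] at h
    rw [h, LinearMap.zero_apply]

/-- **the `A ∘ 𝓕` eigen-relation transports to the `Γ`-model**: if `σ w = γ • Γ⁻¹ ∘ A ∘ 𝓕 ∘ Γ` with `γ ≠ 0` and `Λ` is `σ`-invariant, then
`(Λ ∘ Γ⁻¹) (A (𝓕 f)) = γ⁻¹ · (Λ ∘ Γ⁻¹) f`. [cite: MoeglinVignerasWaldspurger1987, Chap. 2 II.1–II.2] [cite: Rangarao1993, §3.1 (3.9)] -/
theorem functional_comp_symm_op_fourierOpPi_eq [MeasurableSpace F] [BorelSpace F]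
    (μ : Measure F) [μ.IsAddHaarMeasure] {m : ℤ} (hψ : ψ.IsContinuousNontrivial) (hm : ψ.HasConductorExp m)
    {V : Type*} [AddCommGroup V] [Module ℂ V] (Γ : V ≃ₗ[ℂ] SchwartzBruhat (ι → F))
    {G : Type*} (σ : G → V →ₗ[ℂ] V) (w : G) (A : SchwartzBruhat (ι → F) →ₗ[ℂ] SchwartzBruhat (ι → F)) (γ : ℂ) (hγ : γ ≠ 0)
    (hw : ∀ Ψ : V, σ w Ψ = γ • Γ.symm (A (fourierOpPi μ hψ hm (Γ Ψ))))
    (Λ : V →ₗ[ℂ] ℂ) (hΛ : ∀ (g : G) (Ψ : V), Λ (σ g Ψ) = Λ Ψ) (f : SchwartzBruhat (ι → F)) :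
    (Λ ∘ₗ Γ.symm.toLinearMap) (A (fourierOpPi μ hψ hm f)) = γ⁻¹ * (Λ ∘ₗ Γ.symm.toLinearMap) f := by
  have h := hΛ w (Γ.symm f)
  rw [hw, LinearEquiv.apply_symm_apply, map_smul, smul_eq_mul] at h
  simp only [LinearMap.coe_comp, Function.comp_apply, LinearEquiv.coe_coe]
  rw [← h, ← mul_assoc, inv_mul_cancel₀ hγ, one_mul]

/-- **AN INVARIANT FUNCTIONAL READ IN A CONJUGATE MODEL VANISHES — LEVI-FACTOR FORM**: as `functional_eq_zero_of_invariant_of_conjugate_model`, but the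
«Weyl» element acts by `σ w = γ • Γ⁻¹ ∘ A ∘ 𝓕 ∘ Γ` with `A` ANY linear operator reading the value at `0` (`(A g)(0) = κ g(0)`, `κ ≠ 0` — e.g. a Levi
operator `r(m(B))`, ★ `coe_leviOpPi_apply`, the shape of `E″ ι(w_Δ) E″⁻¹ = J⁻¹ · m(B)` in an adapted mover): every `σ`-invariant `Λ` is `0`.
[cite: MoeglinVignerasWaldspurger1987, Chap. 2 II.1–II.2; Chap. 3 §IV.4] [cite: WeilBNT1967, Chap. VII §2, Cor. 1] -/
theorem functional_eq_zero_of_invariant_of_conjugate_model_op [Nonempty ι] [Invertible (2 : F)] [MeasurableSpace F] [BorelSpace F]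
    (μ : Measure F) [μ.IsAddHaarMeasure] {m : ℤ} (hψ : ψ.IsContinuousNontrivial) (hm : ψ.HasConductorExp m)
    (hl : IsLocallyConstant (⇑ψ : F → Circle)) (c : (ι → F) →ₗ[F] (ι → F)) (hc : ∀ x : ι → F, halfForm c x = 0 → x = 0)
    {V : Type*} [AddCommGroup V] [Module ℂ V] (Γ : V ≃ₗ[ℂ] SchwartzBruhat (ι → F))
    {G : Type*} (σ : G → V →ₗ[ℂ] V) (n : F → G)
    (hn : ∀ (b : F) (Ψ : V), σ (n b) Ψ = Γ.symm (unipOpPi hl (b • c) (Γ Ψ)))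
    (w : G) (A : SchwartzBruhat (ι → F) →ₗ[ℂ] SchwartzBruhat (ι → F)) (κ : ℂ) (hκ : κ ≠ 0)
    (hA : ∀ g : SchwartzBruhat (ι → F), ((A g : SchwartzBruhat (ι → F)) : (ι → F) → ℂ) 0 = κ * (g : (ι → F) → ℂ) 0)
    (γ : ℂ) (hw : ∀ Ψ : V, σ w Ψ = γ • Γ.symm (A (fourierOpPi μ hψ hm (Γ Ψ))))
    (Λ : V →ₗ[ℂ] ℂ) (hΛ : ∀ (g : G) (Ψ : V), Λ (σ g Ψ) = Λ Ψ) : Λ = 0 := by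
  by_cases hγ : γ = 0
  · ext Ψ
    rw [← hΛ w Ψ, hw, hγ, zero_smul, map_zero, LinearMap.zero_apply]
  · have hΛ' : Λ ∘ₗ Γ.symm.toLinearMap = 0 :=
      functional_eq_zero_of_forall_unipOpPi_eq_of_op_fourierOpPi μ hψ hm hl c hc (Λ ∘ₗ Γ.symm.toLinearMap)
        (functional_comp_symm_unipOpPi_eq hl c Γ σ n hn Λ hΛ) A κ hκ hA γ⁻¹
        (functional_comp_symm_op_fourierOpPi_eq μ hψ hm Γ σ w A γ hγ hw Λ hΛ)
    ext Ψ
    have h := LinearMap.congr_fun hΛ' (Γ Ψ)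
    rw [LinearMap.coe_comp, Function.comp_apply, LinearEquiv.coe_coe, LinearEquiv.symm_apply_apply,
      LinearMap.zero_apply] at h
    rw [h, LinearMap.zero_apply]

/-! ## §4 ED. 2 — the `𝓕 ∘ A` order (Levi factor INSIDE the Fourier operator: the word `E″ ι(w_Δ) E″⁻¹ = J⁻¹ · m(B)` of the adapted mover,
★ `leraySection_deltaLagrangian_apply_eq_smul_conj_fourierOpPi_leviOpPi`, LD2-plan (g3) DEALS #17 (1)) -/

/-- **(S2″) A FUNCTIONAL SUPPORTED AT `0` IS NOT AN `𝓕 ∘ A`-EIGENFUNCTIONAL** for any linear AUTOMORPHISM `A` of `𝒮(F^ι)` whose inverse preserves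
vanishing at `0` (`(A⁻¹ g)(0) = κ · g(0)`, any `κ`; e.g. a Levi operator `r(m(B))`, ★ `coe_leviOpPi_apply`): `Λ f = 0` whenever `f 0 = 0`, and
`Λ (r(w) (A f)) = γ Λ f` for all `f`, force `Λ = 0` (`ι` non-empty): test `r(w) f₁ = r(w) (A (A⁻¹ f₁))` on `f₁ = 𝟙_{a + (𝔭^N)^ι}`.
[cite: MoeglinVignerasWaldspurger1987, Chap. 2 II.1–II.2; Chap. 3 §IV.4] [cite: WeilBNT1967, Chap. VII §2, Cor. 1] -/
theorem functional_eq_zero_of_forall_apply_zero_of_fourierOpPi_op [Nonempty ι] [MeasurableSpace F] [BorelSpace F]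
    (μ : Measure F) [μ.IsAddHaarMeasure] {m : ℤ} (hψ : ψ.IsContinuousNontrivial) (hm : ψ.HasConductorExp m)
    (Λ : SchwartzBruhat (ι → F) →ₗ[ℂ] ℂ) (hΛ0 : ∀ f : SchwartzBruhat (ι → F), (f : (ι → F) → ℂ) 0 = 0 → Λ f = 0)
    (A : SchwartzBruhat (ι → F) ≃ₗ[ℂ] SchwartzBruhat (ι → F)) (κ : ℂ)
    (hA : ∀ g : SchwartzBruhat (ι → F), ((A.symm g : SchwartzBruhat (ι → F)) : (ι → F) → ℂ) 0 = κ * (g : (ι → F) → ℂ) 0)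
    (γ : ℂ) (hΛF : ∀ f : SchwartzBruhat (ι → F), Λ (fourierOpPi μ hψ hm (A f)) = γ * Λ f) : Λ = 0 := by
  classical
  haveI : SecondCountableTopology F := secondCountableTopology_localField F
  haveI : T2Space F := (isLocalField F).toT2Space
  -- the normalising function `φ = 𝟙_{𝒪^ι}`, `φ 0 = 1`
  let φ : SchwartzBruhat (ι → F) :=
    ⟨(piPrimePowBall F ι 0).indicator fun _ => (1 : ℂ), indicator_piPrimePowBall_mem_schwartzBruhat 0 1⟩
  have hφ : (φ : (ι → F) → ℂ) 0 = 1 := by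
    change (piPrimePowBall F ι 0).indicator (fun _ => (1 : ℂ)) 0 = 1
    exact Set.indicator_of_mem (zero_mem_piPrimePowBall 0) _
  -- a box `(𝔭^N)^ι` missing the non-zero vector `a = (1, …, 1)`
  let a : ι → F := fun _ => 1
  have ha : a ≠ 0 := fun h => one_ne_zero (congr_fun h (Classical.arbitrary ι))
  obtain ⟨N, hN⟩ := exists_piPrimePowBall_subset_of_mem_nhds_zero (F := F) (ι := ι) (isOpen_ne.mem_nhds ha.symm)
  have haN : a ∉ piPrimePowBall F ι (N : ℤ) := fun h => hN h rfl
  -- the test function `f = 𝟙_{a + (𝔭^N)^ι}`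
  let f : SchwartzBruhat (ι → F) :=
    ⟨(a +ᵥ piPrimePowBall F ι (N : ℤ)).indicator fun _ => (1 : ℂ), indicator_vadd_piPrimePowBall_mem_schwartzBruhat (N : ℤ) a 1⟩
  have hf0 : (f : (ι → F) → ℂ) 0 = 0 := by
    change (a +ᵥ piPrimePowBall F ι (N : ℤ)).indicator (fun _ => (1 : ℂ)) 0 = 0
    refine Set.indicator_of_notMem (fun h0 => haN ?_) _
    have h' : (0 : ι → F) - a ∈ piPrimePowBall F ι (N : ℤ) := mem_vadd_piPrimePowBall_iff.1 h0
    rw [zero_sub] at h'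
    simpa using neg_mem_piPrimePowBall h'
  -- its Fourier transform at `0` is the (positive) measure of the box
  have hFf0 : ((fourierOpPi μ hψ hm f : SchwartzBruhat (ι → F)) : (ι → F) → ℂ) 0 =
      ((Measure.pi fun _ : ι => μ).real (piPrimePowBall F ι (N : ℤ)) : ℂ) := by
    rw [coe_fourierOpPi]
    change piFourierSB ψ (Measure.pi fun _ : ι => μ) ((a +ᵥ piPrimePowBall F ι (N : ℤ)).indicator fun _ => (1 : ℂ)) 0 = _
    rw [piFourierSB_indicator_vadd_piPrimePowBall _ hm, dotProduct_zero, AddChar.map_zero_eq_one, Circle.coe_one, one_mul,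
      if_pos (zero_mem_piPrimePowBall _)]
  have hpos : (0 : ℝ) < (Measure.pi fun _ : ι => μ).real (piPrimePowBall F ι (N : ℤ)) := measureReal_piPrimePowBall_pos _ _
  -- `Λ (r(w) f) = Λ (r(w) (A (A⁻¹ f))) = γ Λ (A⁻¹ f) = 0` since `(A⁻¹ f)(0) = κ f(0) = 0`
  have hA0 : ((A.symm f : SchwartzBruhat (ι → F)) : (ι → F) → ℂ) 0 = 0 := by rw [hA, hf0, mul_zero]
  have h1 : Λ (fourierOpPi μ hψ hm f) = 0 := by
    have h := hΛF (A.symm f)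
    rw [A.apply_symm_apply, hΛ0 _ hA0, mul_zero] at h
    exact h
  have h2 := functional_apply_eq_apply_zero_mul Λ hΛ0 φ hφ (fourierOpPi μ hψ hm f)
  rw [h1, hFf0] at h2
  have hunit : Λ φ = 0 := by
    rcases mul_eq_zero.1 h2.symm with h | h
    · exact absurd (by exact_mod_cast h) hpos.ne'
    · exact h
  ext g
  rw [functional_apply_eq_apply_zero_mul Λ hΛ0 φ hφ g, hunit, mul_zero, LinearMap.zero_apply]

/-- **(S1+S2″)**: a functional invariant under every `r(n(b c))` (`halfForm c` anisotropic) with `Λ ∘ 𝓕 ∘ A = γ Λ` for a linear automorphism `A`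
with `(A⁻¹ g)(0) = κ g(0)` is ZERO. [cite: MoeglinVignerasWaldspurger1987, Chap. 2 I.3–I.4, II.1–II.2; Chap. 3 §IV.4] [cite: WeilBNT1967, Chap. VII §2, Cor. 1] -/
theorem functional_eq_zero_of_forall_unipOpPi_eq_of_fourierOpPi_op [Nonempty ι] [Invertible (2 : F)] [MeasurableSpace F] [BorelSpace F]
    (μ : Measure F) [μ.IsAddHaarMeasure] {m : ℤ} (hψ : ψ.IsContinuousNontrivial) (hm : ψ.HasConductorExp m)
    (hl : IsLocallyConstant (⇑ψ : F → Circle)) (c : (ι → F) →ₗ[F] (ι → F)) (hc : ∀ x : ι → F, halfForm c x = 0 → x = 0)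
    (Λ : SchwartzBruhat (ι → F) →ₗ[ℂ] ℂ) (hΛN : ∀ (b : F) (f : SchwartzBruhat (ι → F)), Λ (unipOpPi hl (b • c) f) = Λ f)
    (A : SchwartzBruhat (ι → F) ≃ₗ[ℂ] SchwartzBruhat (ι → F)) (κ : ℂ)
    (hA : ∀ g : SchwartzBruhat (ι → F), ((A.symm g : SchwartzBruhat (ι → F)) : (ι → F) → ℂ) 0 = κ * (g : (ι → F) → ℂ) 0)
    (γ : ℂ) (hΛF : ∀ f : SchwartzBruhat (ι → F), Λ (fourierOpPi μ hψ hm (A f)) = γ * Λ f) : Λ = 0 :=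
  have hψ1 : ∃ a : F, ((ψ a : Circle) : ℂ) ≠ 1 := by
    obtain ⟨a, -, ha⟩ := hm.2
    exact ⟨a, fun h => ha (Circle.ext h)⟩
  functional_eq_zero_of_forall_apply_zero_of_fourierOpPi_op μ hψ hm Λ
    (fun f hf0 => functional_apply_eq_zero_of_forall_unipOpPi_eq hl hψ1 c hc Λ hΛN f hf0) A κ hA γ hΛF

/-- **the `𝓕 ∘ A` eigen-relation transports to the `Γ`-model**: if `σ w = γ • Γ⁻¹ ∘ 𝓕 ∘ A ∘ Γ` with `γ ≠ 0` and `Λ` is `σ`-invariant, then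
`(Λ ∘ Γ⁻¹) (𝓕 (A f)) = γ⁻¹ · (Λ ∘ Γ⁻¹) f`. [cite: MoeglinVignerasWaldspurger1987, Chap. 2 II.1–II.2] [cite: Rangarao1993, §3.1 (3.9)] -/
theorem functional_comp_symm_fourierOpPi_op_eq [MeasurableSpace F] [BorelSpace F]
    (μ : Measure F) [μ.IsAddHaarMeasure] {m : ℤ} (hψ : ψ.IsContinuousNontrivial) (hm : ψ.HasConductorExp m)
    {V : Type*} [AddCommGroup V] [Module ℂ V] (Γ : V ≃ₗ[ℂ] SchwartzBruhat (ι → F))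
    {G : Type*} (σ : G → V →ₗ[ℂ] V) (w : G) (A : SchwartzBruhat (ι → F) ≃ₗ[ℂ] SchwartzBruhat (ι → F)) (γ : ℂ) (hγ : γ ≠ 0)
    (hw : ∀ Ψ : V, σ w Ψ = γ • Γ.symm (fourierOpPi μ hψ hm (A (Γ Ψ))))
    (Λ : V →ₗ[ℂ] ℂ) (hΛ : ∀ (g : G) (Ψ : V), Λ (σ g Ψ) = Λ Ψ) (f : SchwartzBruhat (ι → F)) :
    (Λ ∘ₗ Γ.symm.toLinearMap) (fourierOpPi μ hψ hm (A f)) = γ⁻¹ * (Λ ∘ₗ Γ.symm.toLinearMap) f := by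
  have h := hΛ w (Γ.symm f)
  rw [hw, LinearEquiv.apply_symm_apply, map_smul, smul_eq_mul] at h
  simp only [LinearMap.coe_comp, Function.comp_apply, LinearEquiv.coe_coe]
  rw [← h, ← mul_assoc, inv_mul_cancel₀ hγ, one_mul]

/-- **AN INVARIANT FUNCTIONAL READ IN A CONJUGATE MODEL VANISHES — `𝓕 ∘ A` FORM** (the adapted-mover word `E″ ι(w_Δ) E″⁻¹ = J⁻¹ · m(B)`: the
«Weyl» element acts by `σ w = γ • Γ⁻¹ ∘ 𝓕 ∘ A ∘ Γ`, `A` a linear automorphism of `𝒮(F^ι)` with `(A⁻¹ g)(0) = κ g(0)` — for `A = r(m(B))`,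
`κ = |det B|^{1∕2}` by ★ `coe_leviOpPi_apply`): for ANY operator family `σ` with `σ (n b) = Γ⁻¹ ∘ unipOpPi (b • c) ∘ Γ` (`halfForm c`
anisotropic), every `σ`-invariant linear functional on `V` is `0`. [cite: MoeglinVignerasWaldspurger1987, Chap. 2 II.1–II.2; Chap. 3 §IV.4]
[cite: WeilBNT1967, Chap. VII §2, Cor. 1] -/
theorem functional_eq_zero_of_invariant_of_conjugate_model_fourierOp [Nonempty ι] [Invertible (2 : F)] [MeasurableSpace F] [BorelSpace F]
    (μ : Measure F) [μ.IsAddHaarMeasure] {m : ℤ} (hψ : ψ.IsContinuousNontrivial) (hm : ψ.HasConductorExp m)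
    (hl : IsLocallyConstant (⇑ψ : F → Circle)) (c : (ι → F) →ₗ[F] (ι → F)) (hc : ∀ x : ι → F, halfForm c x = 0 → x = 0)
    {V : Type*} [AddCommGroup V] [Module ℂ V] (Γ : V ≃ₗ[ℂ] SchwartzBruhat (ι → F))
    {G : Type*} (σ : G → V →ₗ[ℂ] V) (n : F → G)
    (hn : ∀ (b : F) (Ψ : V), σ (n b) Ψ = Γ.symm (unipOpPi hl (b • c) (Γ Ψ)))
    (w : G) (A : SchwartzBruhat (ι → F) ≃ₗ[ℂ] SchwartzBruhat (ι → F)) (κ : ℂ)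
    (hA : ∀ g : SchwartzBruhat (ι → F), ((A.symm g : SchwartzBruhat (ι → F)) : (ι → F) → ℂ) 0 = κ * (g : (ι → F) → ℂ) 0)
    (γ : ℂ) (hw : ∀ Ψ : V, σ w Ψ = γ • Γ.symm (fourierOpPi μ hψ hm (A (Γ Ψ))))
    (Λ : V →ₗ[ℂ] ℂ) (hΛ : ∀ (g : G) (Ψ : V), Λ (σ g Ψ) = Λ Ψ) : Λ = 0 := by
  by_cases hγ : γ = 0
  · ext Ψ
    rw [← hΛ w Ψ, hw, hγ, zero_smul, map_zero, LinearMap.zero_apply]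
  · have hΛ' : Λ ∘ₗ Γ.symm.toLinearMap = 0 :=
      functional_eq_zero_of_forall_unipOpPi_eq_of_fourierOpPi_op μ hψ hm hl c hc (Λ ∘ₗ Γ.symm.toLinearMap)
        (functional_comp_symm_unipOpPi_eq hl c Γ σ n hn Λ hΛ) A κ hA γ⁻¹
        (functional_comp_symm_fourierOpPi_op_eq μ hψ hm Γ σ w A γ hγ hw Λ hΛ)
    ext Ψ
    have h := LinearMap.congr_fun hΛ' (Γ Ψ)
    rw [LinearMap.coe_comp, Function.comp_apply, LinearEquiv.coe_coe, LinearEquiv.symm_apply_apply,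
      LinearMap.zero_apply] at h
    rw [h, LinearMap.zero_apply]

end Literature.RepresentationTheory.MoeglinVignerasWaldspurger1987

end
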